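import Summits.CriticalPhenomena.SAWScalingLimit.Theorems.SAWRenewalTightnessConfinementPositivityBridgeTubeCosine
import Summits.CriticalPhenomena.SAWScalingLimit.Theorems.SAWRenewalTightnessConfinementPositivityUnpinnedSlabTubeLemmas
import Summits.CriticalPhenomena.SAWScalingLimit.Theorems.SAWRenewalTightnessConfinementPositivityChainMarkov
import Summits.CriticalPhenomena.SAWScalingLimit.Theorems.SAWRenewalTightnessTubeLowerBoundFlipWord
import HarnessLib

/-!
# Crux `ConfinementPositivity` (stmt-CriticalPhenomena-17587), line `Sketch` (sign-universality):
# stub B′u, core — the per-`k` comparison of the unpinned slab tube in the main regime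

For `k`-tuples of Kesten's irreducible bridges of total span `L` (the Kesten chains with `k` pieces), the
critical mass of the tuples all of whose pieces are SMALL (`b·span ≤ W`) is at most `2e ·` the mass of the
tuples whose concatenation stays in the tube `|y| ≤ W`, provided the one-piece second-moment ceiling U2
(`E_K[ext² | span s] ≤ C s²`) holds and `2·C·(W/b)·L ≤ E₀² + 1` with `E₀ = W/2/2`
(`unpinnedSlabTube_main_k`).  Ingredients: the cosine tube comparison `Theorems.cosineTube_claim`
(`…BridgeTubeCosine.lean`) at the start `y = 0` with tube radius `r = W/2` and extent budget `E₀ = r/2`, whose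
`θ`-weighted mass is `≥ e⁻¹ ·` (mass of the good tuples, `Σ extᵢ² ≤ E₀²`); the Markov budget
`Theorems.chainMarkov_claim` (`…ChainMarkov.lean`), which with U2 bounds the bad tuples by
`C·(W/b)·L/(E₀²+1) ≤ ½` of the small mass; the flip `y ↦ -y` (`FlipWord`) as the symmetry of the piece type;
and the heights-of-a-concatenation lemma `Theorems.unpinnedSlabTube_abs_traj_flatten_le`
(`…UnpinnedSlabTubeLemmas.lean`).  Everything in `ℝ≥0∞`; no definitions.
-/

noncomputable section

open scoped BigOperators ENNReal
open Classical
open Literature.Probability.LatticeModels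
open Literature.Probability.RandomPlanarGeometry Literature.Probability.RandomPlanarGeometry.SAW
open Summit.CriticalPhenomena.SAWScalingLimit.Theorems.TubeLowerBound.SubcriticalRenewalFloor

namespace Summit.CriticalPhenomena.SAWScalingLimit.Theorems

/-- **Per-`k` core of the unpinned slab tube.**  Inputs: the cosine tube comparison, the Markov budget
`chainMarkov_claim`, the heights-of-concatenation lemma `unpinnedSlabTube_abs_traj_flatten_le`, the one-piece second-moment bound U2 with constant
`C`, and the numeric condition `2·C·(W/b)·L ≤ E₀² + 1` (`E₀ = W/2/2`).  Conclusion: for `k`-tuples of irreducible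
bridges of total span `L`, `e⁻¹ ·` (mass with all pieces `b·span ≤ W`) `≤ 2 ·` (mass whose concatenation stays
in the tube `|y| ≤ W`). -/
theorem unpinnedSlabTube_main_k :
    ∀ {C : ℝ}, 0 < C →
    (∀ s : ℕ, 1 ≤ s →
      (∑' w : {w : List Step // IsIrrBridge w},
          if xEnd w.1 = (s : ℤ) then
            (((Finset.range (w.1.length + 1)).sup fun i => (traj w.1 i 1).natAbs : ℕ) : ℝ≥0∞) ^ 2 *
              ENNReal.ofReal (criticalFugacity ^ w.1.length) else 0) ≤
        ENNReal.ofReal (C * (s : ℝ) ^ 2) *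
          ∑' w : {w : List Step // IsIrrBridge w},
            if xEnd w.1 = (s : ℤ) then 1 * ENNReal.ofReal (criticalFugacity ^ w.1.length) else 0) →
    ∀ (W b L k : ℕ), 1 ≤ b → 1 ≤ W / 2 →
    2 * ENNReal.ofReal C * ((W / b : ℕ) : ℝ≥0∞) * (L : ℝ≥0∞) ≤ (((W / 2 / 2) ^ 2 + 1 : ℕ) : ℝ≥0∞) →
    ENNReal.ofReal (Real.exp (-1)) *
        (∑' f : Fin k → {w : List Step // IsIrrBridge w},
          if ((∑ i, xEnd (f i).1) = (L : ℤ) ∧ ∀ i, (b : ℤ) * xEnd (f i).1 ≤ (W : ℤ)) then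
            ∏ i, ENNReal.ofReal (criticalFugacity ^ (f i).1.length) else 0) ≤
      2 * ∑' f : Fin k → {w : List Step // IsIrrBridge w},
          if ((∑ i, xEnd (f i).1) = (L : ℤ) ∧
              ∀ t, |traj (List.ofFn fun i => (f i).1).flatten t 1| ≤ (W : ℤ)) then
            ∏ i, ENNReal.ofReal (criticalFugacity ^ (f i).1.length) else 0 := by
  intro C hC hU W b L k hb hr hnum
  -- the piece type and its data
  set ν : {w : List Step // IsIrrBridge w} → ℝ≥0∞ := fun p => ENNReal.ofReal (criticalFugacity ^ p.1.length)
    with hν_def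
  set ext : {w : List Step // IsIrrBridge w} → ℕ :=
    fun p => (Finset.range (p.1.length + 1)).sup fun i => (traj p.1 i 1).natAbs with hext_def
  set Hh : {w : List Step // IsIrrBridge w} → ℤ := fun p => wEnd p.1 1 with hH_def
  set sp : {w : List Step // IsIrrBridge w} → ℤ := fun p => xEnd p.1 with hsp_def
  set spN : {w : List Step // IsIrrBridge w} → ℕ := fun p => (xEnd p.1).toNat with hspN_def
  set r : ℕ := W / 2 with hr_def
  set E₀ : ℕ := r / 2 with hE₀_def
  set smax : ℕ := W / b with hsmax_def
  have hE : 2 * E₀ ≤ r := by omega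
  have hrE : (r : ℤ) + E₀ ≤ W := by omega
  have hspN : ∀ p : {w : List Step // IsIrrBridge w}, ((spN p : ℕ) : ℤ) = xEnd p.1 := fun p =>
    Int.toNat_of_nonneg (le_trans (by norm_num) (UnpinnedSlabTube.one_le_xEnd p))
  have hb0 : (0 : ℤ) < b := by exact_mod_cast hb
  -- (1) small ↔ `spN ≤ smax`, and the span constraint in `ℕ`
  have hsmall : ∀ p : {w : List Step // IsIrrBridge w}, (b : ℤ) * xEnd p.1 ≤ (W : ℤ) ↔ spN p ≤ smax := by
    intro p
    rw [← hspN p, hsmax_def, ← Int.ofNat_le, Int.natCast_div, Int.le_ediv_iff_mul_le hb0, mul_comm]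
  have hspanN : ∀ {k : ℕ} (f : Fin k → {w : List Step // IsIrrBridge w}),
      (∑ i, xEnd (f i).1) = (L : ℤ) ↔ (∑ i, spN (f i)) = L := by
    intro k f
    rw [← Nat.cast_inj (R := ℤ), Nat.cast_sum]
    simp only [hspN]
  -- (2) the flip as an equivalence of the piece type
  let φ : {w : List Step // IsIrrBridge w} ≃ {w : List Step // IsIrrBridge w} :=
    { toFun := fun w => ⟨w.1.map fun d : Step => if d = 1 then 3 else if d = 3 then 1 else d,
        FlipWord.isIrrBridge_map_flip w.2⟩
      invFun := fun w => ⟨w.1.map fun d : Step => if d = 1 then 3 else if d = 3 then 1 else d,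
        FlipWord.isIrrBridge_map_flip w.2⟩
      left_inv := fun w => Subtype.ext (FlipWord.map_flip_map_flip w.1)
      right_inv := fun w => Subtype.ext (FlipWord.map_flip_map_flip w.1) }
  have hφν : ∀ p, ν (φ p) = ν p := fun p => by
    simp only [hν_def, φ, Equiv.coe_fn_mk, List.length_map]
  have hφH : ∀ p, Hh (φ p) = -Hh p := fun p => UnpinnedSlabTube.wEnd_map_flip_snd p.1
  have hφe : ∀ p, ext (φ p) = ext p := fun p => UnpinnedSlabTube.ext_map_flip p.1
  have hφsp : ∀ p, sp (φ p) = sp p := fun p => FlipWord.xEnd_map_flip p.1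
  have hHe : ∀ p, |Hh p| ≤ (ext p : ℤ) := fun p => UnpinnedSlabTube.abs_wEnd_le_ext p.1
  -- (3) the cosine tube comparison at `y = 0`, `ℓ = L`
  have hcos := cosineTube_claim ν Hh ext sp φ hφν hφH hφe hφsp hHe r E₀ hr hE k 0 (L : ℤ)
    (by simp)
  simp only [Int.cast_zero, mul_zero, Real.cos_zero, ENNReal.ofReal_one, one_mul, zero_add] at hcos
  -- names for the five masses
  set T : ℝ≥0∞ := ∑' f : Fin k → {w : List Step // IsIrrBridge w}, if ((∑ i, sp (f i)) = (L : ℤ) ∧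
      (∀ j ≤ k, |∑ i : Fin k, (if (i : ℕ) < j then Hh (f i) else 0)| ≤ (r : ℤ)) ∧ ∀ i, ext (f i) ≤ E₀) then
        ∏ i, ν (f i) else 0 with hT_def
  set G : ℝ≥0∞ := ∑' f : Fin k → {w : List Step // IsIrrBridge w}, if (∑ i, sp (f i)) = (L : ℤ) then
      ∏ i, (ν (f i) * (if ext (f i) ≤ E₀ then
        ENNReal.ofReal (Real.exp (-((Real.pi / (2 * r)) ^ 2 * (ext (f i) : ℝ) ^ 2))) else 0)) else 0
    with hG_def
  set Tb : ℝ≥0∞ := ∑' f : Fin k → {w : List Step // IsIrrBridge w},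
      if ((∑ i, xEnd (f i).1) = (L : ℤ) ∧ ∀ t, |traj (List.ofFn fun i => (f i).1).flatten t 1| ≤ (W : ℤ)) then
        ∏ i, ENNReal.ofReal (criticalFugacity ^ (f i).1.length) else 0 with hTb_def
  set Mb : ℝ≥0∞ := ∑' f : Fin k → {w : List Step // IsIrrBridge w},
      if ((∑ i, xEnd (f i).1) = (L : ℤ) ∧ ∀ i, (b : ℤ) * xEnd (f i).1 ≤ (W : ℤ)) then
        ∏ i, ENNReal.ofReal (criticalFugacity ^ (f i).1.length) else 0 with hMb_def
  set good : ℝ≥0∞ := ∑' f : Fin k → {w : List Step // IsIrrBridge w},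
      if (((∑ i, xEnd (f i).1) = (L : ℤ) ∧ ∀ i, (b : ℤ) * xEnd (f i).1 ≤ (W : ℤ)) ∧
          (∑ i, ext (f i) ^ 2) ≤ E₀ ^ 2) then
        ∏ i, ENNReal.ofReal (criticalFugacity ^ (f i).1.length) else 0 with hgood_def
  set bad : ℝ≥0∞ := ∑' f : Fin k → {w : List Step // IsIrrBridge w},
      if (((∑ i, xEnd (f i).1) = (L : ℤ) ∧ ∀ i, (b : ℤ) * xEnd (f i).1 ≤ (W : ℤ)) ∧
          E₀ ^ 2 < (∑ i, ext (f i) ^ 2)) then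
        ∏ i, ENNReal.ofReal (criticalFugacity ^ (f i).1.length) else 0 with hbad_def
  change G ≤ T at hcos
  change ENNReal.ofReal (Real.exp (-1)) * Mb ≤ 2 * Tb
  -- (4) `T ≤ Tb`: the piece-boundary tube + small extents give the real tube (F4a at `y = 0`)
  have hTTb : T ≤ Tb := by
    refine ENNReal.tsum_le_tsum fun f => ?_
    by_cases hc : (∑ i, sp (f i)) = (L : ℤ) ∧
        (∀ j ≤ k, |∑ i : Fin k, (if (i : ℕ) < j then Hh (f i) else 0)| ≤ (r : ℤ)) ∧ ∀ i, ext (f i) ≤ E₀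
    · have htube : (∑ i, xEnd (f i).1) = (L : ℤ) ∧
          ∀ t, |traj (List.ofFn fun i => (f i).1).flatten t 1| ≤ (W : ℤ) := by
        refine ⟨hc.1, fun t => ?_⟩
        have hbnd : ∀ j ≤ k, |(0 : ℤ) + ∑ i : Fin k, (if (i : ℕ) < j then wEnd (f i).1 1 else 0)| ≤ (r : ℤ) :=
          fun j hj => by rw [zero_add]; exact hc.2.1 j hj
        have hexts : ∀ i,
            (((Finset.range ((f i).1.length + 1)).sup fun t => (traj (f i).1 t 1).natAbs : ℕ) : ℤ) ≤ (E₀ : ℤ) :=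
          fun i => by exact_mod_cast hc.2.2 i
        have h := unpinnedSlabTube_abs_traj_flatten_le (r : ℤ) (E₀ : ℤ) (Int.natCast_nonneg E₀) k (fun i => (f i).1) 0 hbnd hexts t
        rw [zero_add] at h
        exact h.trans hrE
      rw [if_pos hc, if_pos htube]
    · rw [if_neg hc]
      exact zero_le
  -- (5) `e⁻¹ · good ≤ G`: on good tuples every factor `θ` is `≥`… and the product is `≥ e⁻¹`
  have hstep : ∀ e : ℕ, e ≤ E₀ → 0 ≤ Real.pi / (2 * r) * e ∧ Real.pi / (2 * r) * e ≤ Real.pi / 4 :=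
    fun e he => rademacherTube_step_angle r e hr (le_trans (Nat.mul_le_mul_left 2 he) hE)
  have hgoodG : ENNReal.ofReal (Real.exp (-1)) * good ≤ G := by
    rw [hgood_def, ← ENNReal.tsum_mul_left]
    refine ENNReal.tsum_le_tsum fun f => ?_
    by_cases hc : ((∑ i, xEnd (f i).1) = (L : ℤ) ∧ ∀ i, (b : ℤ) * xEnd (f i).1 ≤ (W : ℤ)) ∧
        (∑ i, ext (f i) ^ 2) ≤ E₀ ^ 2
    · rw [if_pos hc, if_pos (show (∑ i, sp (f i)) = (L : ℤ) from hc.1.1)]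
      have hei : ∀ i, ext (f i) ≤ E₀ := fun i => by
        have h1 : ext (f i) ^ 2 ≤ E₀ ^ 2 :=
          le_trans (Finset.single_le_sum (f := fun i => ext (f i) ^ 2) (fun _ _ => Nat.zero_le _)
            (Finset.mem_univ i)) hc.2
        exact (Nat.pow_le_pow_iff_left (by norm_num)).1 h1
      rw [Finset.prod_mul_distrib, mul_comm]
      refine mul_le_mul_right ?_ _
      -- `e⁻¹ ≤ ∏ θ`
      have hθ : ∀ i, (if ext (f i) ≤ E₀ then
          ENNReal.ofReal (Real.exp (-((Real.pi / (2 * r)) ^ 2 * (ext (f i) : ℝ) ^ 2))) else 0) =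
          ENNReal.ofReal (Real.exp (-((Real.pi / (2 * r)) ^ 2 * (ext (f i) : ℝ) ^ 2))) :=
        fun i => if_pos (hei i)
      simp only [hθ]
      rw [← ENNReal.ofReal_prod_of_nonneg (fun i _ => (Real.exp_pos _).le), ← Real.exp_sum]
      refine ENNReal.ofReal_le_ofReal (Real.exp_le_exp.2 ?_)
      -- `-1 ≤ -a² Σ ext² `, i.e. `a² Σ ext² ≤ 1`, from `a² Σ ext² ≤ a² E₀² ≤ (π/4)² ≤ 1`
      have hsumR : ∑ i, -((Real.pi / (2 * r)) ^ 2 * (ext (f i) : ℝ) ^ 2) =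
          -((Real.pi / (2 * r)) ^ 2 * ∑ i, (ext (f i) : ℝ) ^ 2) := by
        rw [Finset.mul_sum, ← Finset.sum_neg_distrib]
      rw [hsumR, neg_le_neg_iff]
      have hsum' : (∑ i, (ext (f i) : ℝ) ^ 2) ≤ (E₀ : ℝ) ^ 2 := by exact_mod_cast hc.2
      obtain ⟨h0, h1⟩ := hstep E₀ le_rfl
      calc (Real.pi / (2 * r)) ^ 2 * ∑ i, (ext (f i) : ℝ) ^ 2
          ≤ (Real.pi / (2 * r)) ^ 2 * (E₀ : ℝ) ^ 2 := mul_le_mul_of_nonneg_left hsum' (sq_nonneg _)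
        _ = (Real.pi / (2 * r) * E₀) ^ 2 := by ring
        _ ≤ (Real.pi / 4) ^ 2 := pow_le_pow_left₀ h0 h1 2
        _ ≤ 1 := by nlinarith [Real.pi_le_four, Real.pi_pos]
    · rw [if_neg hc, mul_zero]
      exact zero_le
  -- (6) Markov through F3: `(E₀² + 1) · bad ≤ C · smax · L · Mb`
  have hF3hyp : ∀ s : ℕ, s ≤ smax →
      (∑' p : {w : List Step // IsIrrBridge w}, if spN p = s then ((ext p : ℕ) : ℝ≥0∞) ^ 2 * ν p else 0) ≤
        ENNReal.ofReal C * (s : ℝ≥0∞) ^ 2 *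
          ∑' p : {w : List Step // IsIrrBridge w}, if spN p = s then ν p else 0 := by
    intro s _
    rcases Nat.eq_zero_or_pos s with rfl | hs
    · -- no piece has span 0
      have h0 : ∀ p : {w : List Step // IsIrrBridge w}, ¬ spN p = 0 := fun p h => by
        have := hspN p
        rw [h] at this
        have := UnpinnedSlabTube.one_le_xEnd p
        omega
      simp only [h0, if_false, tsum_zero]
      exact zero_le
    · have hiff : ∀ p : {w : List Step // IsIrrBridge w}, spN p = s ↔ xEnd p.1 = (s : ℤ) := fun p => by
        rw [← hspN p, Nat.cast_inj]
      have h := hU s hs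
      simp only [one_mul] at h
      have hC' : ENNReal.ofReal (C * (s : ℝ) ^ 2) = ENNReal.ofReal C * (s : ℝ≥0∞) ^ 2 := by
        rw [ENNReal.ofReal_mul hC.le, ENNReal.ofReal_pow (Nat.cast_nonneg _), ENNReal.ofReal_natCast]
      rw [hC'] at h
      simp only [hiff]
      exact h
  have hF3c := chainMarkov_claim ν (fun p => ((ext p : ℕ) : ℝ≥0∞) ^ 2) spN (ENNReal.ofReal C) smax hF3hyp k L
  -- rewrite the F3 sums in the `ℤ`-span / `b·span ≤ W` form
  have hcondN : ∀ f : Fin k → {w : List Step // IsIrrBridge w},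
      ((∑ i, spN (f i)) = L ∧ ∀ i, spN (f i) ≤ smax) ↔
        ((∑ i, xEnd (f i).1) = (L : ℤ) ∧ ∀ i, (b : ℤ) * xEnd (f i).1 ≤ (W : ℤ)) := fun f => by
    rw [hspanN f]
    simp only [hsmall]
  simp only [hcondN] at hF3c
  change (∑' f : Fin k → {w : List Step // IsIrrBridge w},
      if ((∑ i, xEnd (f i).1) = (L : ℤ) ∧ ∀ i, (b : ℤ) * xEnd (f i).1 ≤ (W : ℤ)) then
        (∑ i, ((ext (f i) : ℕ) : ℝ≥0∞) ^ 2) * ∏ i, ν (f i) else 0) ≤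
      ENNReal.ofReal C * smax * L * Mb at hF3c
  have hbadA : (((E₀ ^ 2 + 1 : ℕ) : ℝ≥0∞)) * bad ≤
      ∑' f : Fin k → {w : List Step // IsIrrBridge w},
        if ((∑ i, xEnd (f i).1) = (L : ℤ) ∧ ∀ i, (b : ℤ) * xEnd (f i).1 ≤ (W : ℤ)) then
          (∑ i, ((ext (f i) : ℕ) : ℝ≥0∞) ^ 2) * ∏ i, ν (f i) else 0 := by
    rw [hbad_def, ← ENNReal.tsum_mul_left]
    refine ENNReal.tsum_le_tsum fun f => ?_
    by_cases hc : ((∑ i, xEnd (f i).1) = (L : ℤ) ∧ ∀ i, (b : ℤ) * xEnd (f i).1 ≤ (W : ℤ)) ∧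
        E₀ ^ 2 < (∑ i, ext (f i) ^ 2)
    · rw [if_pos hc, if_pos hc.1]
      refine mul_le_mul_left ?_ _
      have h1 : E₀ ^ 2 + 1 ≤ ∑ i, ext (f i) ^ 2 := hc.2
      calc (((E₀ ^ 2 + 1 : ℕ) : ℝ≥0∞)) ≤ ((∑ i, ext (f i) ^ 2 : ℕ) : ℝ≥0∞) := by exact_mod_cast h1
        _ = ∑ i, ((ext (f i) : ℕ) : ℝ≥0∞) ^ 2 := by push_cast; rfl
    · rw [if_neg hc, mul_zero]
      exact zero_le
  -- (7) `Mb = good + bad`, `bad ≤ 1`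
  have hsplit : Mb = good + bad := by
    rw [hMb_def, hgood_def, hbad_def, ← ENNReal.tsum_add]
    refine tsum_congr fun f => ?_
    by_cases hc : (∑ i, xEnd (f i).1) = (L : ℤ) ∧ ∀ i, (b : ℤ) * xEnd (f i).1 ≤ (W : ℤ)
    · by_cases hA : (∑ i, ext (f i) ^ 2) ≤ E₀ ^ 2
      · rw [if_pos hc, if_pos ⟨hc, hA⟩, if_neg (fun h => absurd h.2 (not_lt.2 hA)), add_zero]
      · rw [if_pos hc, if_neg (fun h => hA h.2), if_pos ⟨hc, not_le.1 hA⟩, zero_add]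
    · rw [if_neg hc, if_neg (fun h => hc h.1), if_neg (fun h => hc h.1), add_zero]
  have hbad1 : bad ≠ ⊤ := by
    refine ne_top_of_le_ne_top ENNReal.one_ne_top ?_
    rw [hbad_def]
    exact UnpinnedSlabTube.tsum_ite_prod_weight_le_one k _
  -- (8) `2 · bad ≤ Mb`, hence `Mb ≤ 2 · good`
  have h2bad : 2 * bad ≤ Mb := by
    have hE1 : (((E₀ ^ 2 + 1 : ℕ) : ℝ≥0∞)) ≠ 0 := by exact_mod_cast Nat.add_one_ne_zero (E₀ ^ 2)
    have hE2 : (((E₀ ^ 2 + 1 : ℕ) : ℝ≥0∞)) ≠ ⊤ := ENNReal.natCast_ne_top _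
    rw [← ENNReal.mul_le_mul_iff_right hE1 hE2]
    calc (((E₀ ^ 2 + 1 : ℕ) : ℝ≥0∞)) * (2 * bad) = 2 * ((((E₀ ^ 2 + 1 : ℕ) : ℝ≥0∞)) * bad) := by ring
      _ ≤ 2 * (ENNReal.ofReal C * smax * L * Mb) := mul_le_mul_right (hbadA.trans hF3c) 2
      _ = (2 * ENNReal.ofReal C * ((W / b : ℕ) : ℝ≥0∞) * (L : ℝ≥0∞)) * Mb := by
          rw [hsmax_def]; ring
      _ ≤ (((W / 2 / 2) ^ 2 + 1 : ℕ) : ℝ≥0∞) * Mb := mul_le_mul_left hnum _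
      _ = (((E₀ ^ 2 + 1 : ℕ) : ℝ≥0∞)) * Mb := by rw [hE₀_def, hr_def]
  have hMb2 : Mb ≤ 2 * good := by
    have h1 : bad + bad ≤ good + bad := by
      calc bad + bad = 2 * bad := (two_mul bad).symm
        _ ≤ Mb := h2bad
        _ = good + bad := hsplit
    have h2 : bad ≤ good := (ENNReal.add_le_add_iff_right hbad1).1 h1
    calc Mb = good + bad := hsplit
      _ ≤ good + good := add_le_add le_rfl h2
      _ = 2 * good := (two_mul good).symm
  -- (9) assemble
  calc ENNReal.ofReal (Real.exp (-1)) * Mb ≤ ENNReal.ofReal (Real.exp (-1)) * (2 * good) :=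
        mul_le_mul_right hMb2 _
    _ = 2 * (ENNReal.ofReal (Real.exp (-1)) * good) := by ring
    _ ≤ 2 * G := by gcongr
    _ ≤ 2 * T := by gcongr
    _ ≤ 2 * Tb := by gcongr


end Summit.CriticalPhenomena.SAWScalingLimit.Theorems
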